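import Literature.NumberTheory.EllipticCurves.OrdinaryReductionFrobeniusHomProofs
import Literature.NumberTheory.EllipticCurves.WeilPairingProofs
import Literature.NumberTheory.EllipticCurves.FrobeniusTateModule
import Literature.NumberTheory.EllipticCurves.TateModuleProofs
import Literature.NumberTheory.EllipticCurves.GaloisActionProofs
import Mathlib.Data.ZMod.QuotientGroup
import HarnessLib

/-!
# Bricks for Imai's finiteness on the potentially ORDINARY rows: Frobenius-power fixed points, divisible subgroups with
# finite image, and WEIL-PAIRING ANNIHILATORS (route-free helper for crux M = stmt-BirchSwinnertonDyer-19196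
# `ReducibleKatoMember`, K9 / K8-t′; seat `bsd-potss-rkm` g32; FILE 1 of 3)

The kernel proof of Imai's theorem `W(ℚ_{p,∞})[p^∞] < ∞` at a potentially ORDINARY odd prime (FILE 3,
`KatoDescentPotSupersingularTowerTorsionFiniteOrdinary.lean`) runs: reduce Fin_v to «no `p`-divisible line fixed pointwise by the
local tower group» (kmc's line-free reduction), transport to a place `w` of good ORDINARY reduction of a number field `F`, and kill
the line there by the LOCAL ORDINARY LEMMA (FILE 2) — whose three elementary bricks are proved here, for any elliptic curve:

* §1 `finite_setOf_frobenius_pow_smul_eq` — over a finite field `k` with `q` elements only finitely many points of `V(k̄)` are fixed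
  by a POWER `σ_q^e` (`e ≥ 1`) of the arithmetic Frobenius (their coordinates are roots of `X^{q^e} - X`);
* §2 `le_ker_of_divisible_of_finite_map` — a `p`-primary `p`-DIVISIBLE subgroup whose image under a homomorphism `f` is finite lies in
  `ker f` (multiplication by `p` on the finite image is onto, hence injective);
* §3 `smul_sub_mem_zmultiples_of_fixing_rootsOfUnity` — **Weil-pairing annihilators**: over a perfect field `F` with `p ≠ char F`, if
  `σ ∈ Γ_F` fixes every `p`-power root of unity and a point `P ∈ E(F̄)` of exact order `p^n`, then `σR - R ∈ ℤ·P` for EVERY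
  `R ∈ E[p^n]`: `e_{p^n}(P, σR) = e_{p^n}(σP, σR) = σ·e_{p^n}(P, R) = e_{p^n}(P, R)`, so `σR - R` is annihilated by `P`; and the
  annihilator of `P` is exactly `ℤ·P` — it contains `ℤ·P` (alternating), and by counting (`#E[p^n] = p^{2n}`, Silverman III.6.4, with a
  value `e_{p^n}(P, S₀)` of exact order `p^n` from non-degeneracy at `p^{n-1}P ≠ 0`) it has at most `p^n` elements.  (The tree's Weil
  pairing `WeierstrassCurve.exists_weilPairing_holds` is a THEOREM.)

Theorems only (no definition, no named fact, no `sorry`); route-free; closes nothing by itself; BSD is proved for no curve.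

References: [SilvermanAEC2009] Prop. III.8.1 (Weil pairing), Cor. III.6.4, V.§1 (proof of Thm. V.1.1); [Imai1975] Theorem (p. 12)
(the consumer); [GreenbergLNM1716] §1 p. 62.
-/

-- the summit and its single problem are both named `BirchSwinnertonDyer` (registry layout D-0017)
set_option linter.dupNamespace false
set_option autoImplicit false

noncomputable section

open scoped Classical NumberField AddSubgroup
open Function Field NumberField IsDedekindDomain WeierstrassCurve
open Literature.NumberTheory.EllipticCurves
open Literature.NumberTheory.GaloisRepresentations

universe u

namespace Summit.BirchSwinnertonDyer.BirchSwinnertonDyer.Theorems.TowerTorsionFiniteOrdinary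

/-! ## §1 Only finitely many points of `Ẽ(k̄)` are fixed by a power of the Frobenius -/

/-- For a finite field `k` with `q` elements, `σ` the `q`-power Frobenius of `k̄` and `e ≥ 1`, only finitely many
geometric points of a Weierstrass curve `V/k` are fixed by `σ^e` (their coordinates are roots of `X^{q^e} - X`).
[cite: SilvermanAEC2009, V.§1 (proof of Thm. V.1.1)] -/
theorem finite_setOf_frobenius_pow_smul_eq {k : Type u} [Field k] [Finite k] (V : WeierstrassCurve k)
    {σ : absoluteGaloisGroup k} (hσ : ∀ x : AlgebraicClosure k, σ • x = x ^ Nat.card k)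
    {e : ℕ} (he : 1 ≤ e) : {P : V.geomPoints | σ ^ e • P = P}.Finite := by
  have hq : 1 < Nat.card k := Finite.one_lt_card
  set Q : ℕ := Nat.card k ^ e with hQdef
  have hQ : 1 < Q := Nat.one_lt_pow (by omega) hq
  have hσe : ∀ (n : ℕ) (x : AlgebraicClosure k), σ ^ n • x = x ^ Nat.card k ^ n := by
    intro n
    induction n with
    | zero => intro x; rw [pow_zero, one_smul, pow_zero, pow_one]
    | succ n ih => intro x; rw [pow_succ, mul_smul, hσ, smul_pow', ih, ← pow_mul, ← pow_succ]
  -- the roots of `X^Q - X`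
  set R : Set (AlgebraicClosure k) := {x | x ^ Q = x} with hRdef
  have hR : R.Finite := by
    have hf0 : (Polynomial.X ^ Q - Polynomial.X : Polynomial (AlgebraicClosure k)) ≠ 0 :=
      FiniteField.X_pow_card_sub_X_ne_zero (AlgebraicClosure k) hQ
    refine ((Polynomial.X ^ Q - Polynomial.X : Polynomial (AlgebraicClosure k)).roots.toFinset.finite_toSet).subset ?_
    intro x hx
    rw [hRdef, Set.mem_setOf_eq] at hx
    rw [Finset.mem_coe, Multiset.mem_toFinset, Polynomial.mem_roots hf0, Polynomial.IsRoot.def,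
      Polynomial.eval_sub, Polynomial.eval_pow, Polynomial.eval_X, hx, sub_self]
  -- coordinates
  let g : V.geomPoints → Option (AlgebraicClosure k × AlgebraicClosure k) := fun P ↦
    match (P : (V.baseChange (AlgebraicClosure k)).toAffine.Point) with
    | .zero => none
    | .some x y _ => some (x, y)
  have hg : Function.Injective g := by
    intro P P' hPQ
    change (V.baseChange (AlgebraicClosure k)).toAffine.Point at P P'
    rcases P with _ | ⟨x, y, h⟩ <;> rcases P' with _ | ⟨x', y', h'⟩
    · rfl
    · exact (Option.some_ne_none _ hPQ.symm).elim
    · exact (Option.some_ne_none _ hPQ).elim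
    · simp only [g, Option.some.injEq, Prod.mk.injEq] at hPQ
      obtain ⟨rfl, rfl⟩ := hPQ
      rfl
  have hT : (insert none ((fun xy : AlgebraicClosure k × AlgebraicClosure k ↦ some xy) '' (R ×ˢ R))).Finite :=
    ((hR.prod hR).image _).insert none
  refine (hT.preimage hg.injOn).subset ?_
  intro P hP
  rw [Set.mem_setOf_eq] at hP
  rw [Set.mem_preimage]
  change (V.baseChange (AlgebraicClosure k)).toAffine.Point at P
  rcases P with _ | ⟨x, y, h⟩
  · exact Set.mem_insert _ _
  · refine Set.mem_insert_of_mem _ ⟨(x, y), ?_, rfl⟩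
    have hmap : Affine.Point.map
        ((show AlgebraicClosure k ≃ₐ[k] AlgebraicClosure k from σ ^ e) :
          AlgebraicClosure k →ₐ[k] AlgebraicClosure k) (.some x y h) = .some x y h := hP
    rw [Affine.Point.map_some] at hmap
    simp only [Affine.Point.some.injEq] at hmap
    obtain ⟨hx, hy⟩ := hmap
    replace hx : x ^ Q = x := by rw [hQdef, ← hσe e x]; exact hx
    replace hy : y ^ Q = y := by rw [hQdef, ← hσe e y]; exact hy
    exact ⟨hx, hy⟩

/-! ## §2 A `p`-divisible `p`-primary subgroup with finite image lies in the kernel -/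

/-- A `p`-primary, `p`-divisible subgroup `N` whose image under a homomorphism `f` is finite lies in `ker f`:
multiplication by `p` on the finite image is surjective, hence injective, so the image has no `p`-torsion, hence is `0`.
[folklore] -/
theorem le_ker_of_divisible_of_finite_map {A B : Type*} [AddCommGroup A] [AddCommGroup B] (f : A →+ B) (p : ℕ)
    (N : AddSubgroup A) (hprim : ∀ c ∈ N, ∃ k : ℕ, p ^ k • c = 0) (hdiv : ∀ c ∈ N, ∃ c' ∈ N, p • c' = c)
    (hfin : ((N.map f : AddSubgroup B) : Set B).Finite) : N ≤ f.ker := by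
  set Q : AddSubgroup B := N.map f with hQdef
  haveI : Finite Q := hfin.to_subtype
  let m : Q → Q := fun q ↦ ⟨p • (q : B), Q.nsmul_mem q.2 p⟩
  have hmsurj : Function.Surjective m := by
    rintro ⟨_, c, hc, rfl⟩
    obtain ⟨c', hc', hpc'⟩ := hdiv c hc
    exact ⟨⟨f c', ⟨c', hc', rfl⟩⟩, Subtype.ext (by change p • f c' = f c; rw [← map_nsmul, hpc'])⟩
  have hminj : Function.Injective m := Finite.injective_iff_surjective.mpr hmsurj
  have hkill : ∀ q : Q, p • (q : B) = 0 → q = 0 := by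
    intro q hq
    apply hminj
    apply Subtype.ext
    change p • (q : B) = p • ((0 : Q) : B)
    rw [hq, ZeroMemClass.coe_zero, smul_zero]
  have hkillpow : ∀ (k : ℕ) (q : Q), p ^ k • (q : B) = 0 → q = 0 := by
    intro k
    induction k with
    | zero => intro q hq; rw [pow_zero, one_smul] at hq; exact Subtype.ext hq
    | succ k ih =>
      intro q hq
      rw [pow_succ', mul_smul] at hq
      have h1 : (⟨p ^ k • (q : B), Q.nsmul_mem q.2 _⟩ : Q) = 0 :=
        hkill ⟨p ^ k • (q : B), Q.nsmul_mem q.2 _⟩ hq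
      exact ih q (congrArg Subtype.val h1)
  intro c hc
  rw [AddMonoidHom.mem_ker]
  obtain ⟨k, hk⟩ := hprim c hc
  have h := hkillpow k ⟨f c, ⟨c, hc, rfl⟩⟩ (by
    change p ^ k • f c = 0
    rw [← map_nsmul, hk, map_zero])
  exact congrArg Subtype.val h

/-! ## §3 The Weil pairing: an element fixing `μ_{p^∞}` and a point `P` of order `p^n` moves `E[p^n]` inside `ℤ·P` -/

/-- **Annihilators under the Weil pairing.**  Let `E/F` be an elliptic curve over a perfect field with `p ≠ char F`,
`σ ∈ Γ_F` an element fixing every `p`-power root of unity of `F̄` and a point `P ∈ E(F̄)` of exact order `p^n`.  Then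
`σ` moves every `R ∈ E[p^n]` inside `ℤ·P`: `σ R - R ∈ ℤ·P`.  Proof: `e_{p^n}(P, σR) = e_{p^n}(σP, σR) = σ e_{p^n}(P, R) =
e_{p^n}(P, R)`, so `σ R - R` lies in the annihilator of `P`, which is `ℤ·P` by counting (`#E[p^n] = p^{2n}`, and
`S ↦ e_{p^n}(P, S)` takes a value of exact order `p^n` by non-degeneracy at `p^{n-1} P ≠ 0`).
[cite: SilvermanAEC2009, Prop. III.8.1 and Cor. III.6.4] -/
theorem smul_sub_mem_zmultiples_of_fixing_rootsOfUnity {F : Type u} [Field F] [PerfectField F]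
    (E : WeierstrassCurve F) [E.IsElliptic] {p : ℕ} (hp : p.Prime) (hpF : (p : F) ≠ 0) {n : ℕ}
    {σ : absoluteGaloisGroup F} (hσμ : ∀ (k : ℕ) (ξ : AlgebraicClosure F), ξ ^ p ^ k = 1 → σ • ξ = ξ)
    {P : geomPoints E} (hPord : addOrderOf P = p ^ n) (hσP : σ • P = P)
    {R : geomPoints E} (hR : R ∈ geomTorsion E ((p ^ n : ℕ) : ℤ)) :
    σ • R - R ∈ AddSubgroup.zmultiples P := by
  haveI := Fact.mk hp
  rcases n with _ | n
  · -- `E[1] = 0`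
    have hR0 : R = 0 := by
      have h := (mem_geomTorsion_iff E _ R).mp hR
      rwa [pow_zero, Nat.cast_one, one_smul] at h
    rw [hR0, smul_zero, sub_zero]
    exact AddSubgroup.zero_mem _
  set m : ℕ := p ^ (n + 1) with hmdef
  have hm0 : m ≠ 0 := pow_ne_zero _ hp.ne_zero
  have hm2 : 2 ≤ m := le_trans hp.two_le (by rw [hmdef, pow_succ]; exact Nat.le_mul_of_pos_left p (pow_pos hp.pos n))
  have hmF : (m : F) ≠ 0 := by rw [hmdef, Nat.cast_pow]; exact pow_ne_zero _ hpF
  obtain ⟨e, hpow, haddl, haddr, halt, hnd, hgal⟩ := E.exists_weilPairing_holds m hm2 hmF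
  -- elementary consequences of bilinearity
  have hne : ∀ S U : geomTorsion E (m : ℤ), e S U ≠ 0 := fun S U h0 ↦ by
    have h1 := hpow S U
    rw [h0, zero_pow hm0] at h1
    exact zero_ne_one h1
  have he0r : ∀ S : geomTorsion E (m : ℤ), e S 0 = 1 := fun S ↦ by
    have h := haddr S 0 0
    rw [add_zero] at h
    exact (mul_eq_left₀ (hne S 0)).mp h.symm
  have he0l : ∀ U : geomTorsion E (m : ℤ), e 0 U = 1 := fun U ↦ by
    have h := haddl 0 0 U
    rw [add_zero] at h
    exact (mul_eq_left₀ (hne 0 U)).mp h.symm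
  have hskew : ∀ S U : geomTorsion E (m : ℤ), e S U * e U S = 1 := fun S U ↦ by
    have h := halt (S + U)
    rw [haddl, haddr, haddr, halt, halt, one_mul, mul_one] at h
    exact h
  have hnsmul_left : ∀ (j : ℕ) (S U : geomTorsion E (m : ℤ)), e (j • S) U = e S U ^ j := by
    intro j S U
    induction j with
    | zero => rw [zero_smul, pow_zero, he0l]
    | succ j ih => rw [succ_nsmul, haddl, ih, pow_succ]
  -- `P` as a point of `E[m]`
  have hPm : P ∈ geomTorsion E (m : ℤ) := by
    rw [mem_geomTorsion_iff, natCast_zsmul, ← hPord]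
    exact addOrderOf_nsmul_eq_zero P
  set Pt : geomTorsion E (m : ℤ) := ⟨P, hPm⟩ with hPtdef
  have hPtord : addOrderOf Pt = m := by
    have h := addOrderOf_injective (geomTorsion E (m : ℤ)).subtype Subtype.coe_injective Pt
    rw [← h]
    exact hPord
  -- the character `S ↦ e(P, S)` of `E[m]`
  let ψ : geomTorsion E (m : ℤ) →+ Additive ((AlgebraicClosure F)ˣ) :=
    { toFun := fun S ↦ Additive.ofMul (Units.mk0 (e Pt S) (hne Pt S))
      map_zero' := by
        rw [ofMul_eq_zero]
        exact Units.ext (by rw [Units.val_mk0, he0r, Units.val_one])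
      map_add' := fun S U ↦ by
        rw [← ofMul_mul]
        congr 1
        exact Units.ext (by rw [Units.val_mk0, Units.val_mul, Units.val_mk0, Units.val_mk0, haddr]) }
  have hψ : ∀ S : geomTorsion E (m : ℤ), ψ S = Additive.ofMul (Units.mk0 (e Pt S) (hne Pt S)) := fun S ↦ rfl
  have hker : ∀ S : geomTorsion E (m : ℤ), S ∈ ψ.ker ↔ e Pt S = 1 := fun S ↦ by
    rw [AddMonoidHom.mem_ker, hψ, ofMul_eq_zero, ← Units.val_eq_one, Units.val_mk0]
  -- `ℤ·P ≤ ker ψ`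
  have hle : AddSubgroup.zmultiples Pt ≤ ψ.ker :=
    AddSubgroup.zmultiples_le_of_mem ((hker Pt).mpr (halt Pt))
  -- `#E[m] = p^{2(n+1)}`, `E[m]` finite
  have hcardT : Nat.card (geomTorsion E (m : ℤ)) = p ^ (2 * (n + 1)) :=
    card_geomTorsion_pow_eq E p (card_torsionPoints_eq_sq_holds E (AlgebraicClosure F)) hpF (n + 1)
  haveI : Finite (geomTorsion E (m : ℤ)) :=
    Nat.finite_of_card_ne_zero (by rw [hcardT]; exact pow_ne_zero _ hp.ne_zero)
  -- a value of `e(P, ·)` of exact order `m`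
  have hPt' : p ^ n • Pt ≠ 0 := by
    intro h0
    have h1 : addOrderOf Pt ∣ p ^ n := addOrderOf_dvd_of_nsmul_eq_zero h0
    rw [hPtord, hmdef] at h1
    exact absurd (Nat.le_of_dvd (pow_pos hp.pos n) h1) (not_le.mpr (Nat.pow_lt_pow_right hp.one_lt (by omega)))
  obtain ⟨S₀, hS₀⟩ : ∃ S₀ : geomTorsion E (m : ℤ), e (p ^ n • Pt) S₀ ≠ 1 := by
    by_contra hall
    push Not at hall
    have h2 : ∀ S : geomTorsion E (m : ℤ), e S (p ^ n • Pt) = 1 := fun S ↦ by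
      have h := hskew S (p ^ n • Pt)
      rw [hall S, mul_one] at h
      exact h
    exact hPt' (hnd _ h2)
  have hord : orderOf (e Pt S₀) = p ^ (n + 1) := by
    refine orderOf_eq_prime_pow ?_ (hpow Pt S₀)
    rw [← hnsmul_left]; exact hS₀
  -- counting: `#ker ψ ≤ p^{n+1}`
  have hdvd : p ^ (n + 1) ∣ Nat.card ψ.range := by
    have h0 : addOrderOf (ψ S₀) = p ^ (n + 1) := by
      rw [hψ, addOrderOf_ofMul_eq_orderOf, ← orderOf_units, Units.val_mk0, hord]
    have h1 : addOrderOf (⟨ψ S₀, ⟨S₀, rfl⟩⟩ : ψ.range) = p ^ (n + 1) := by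
      rw [← h0]
      exact (addOrderOf_injective ψ.range.subtype Subtype.coe_injective _).symm
    rw [← h1]
    exact addOrderOf_dvd_natCard _
  have hcard_ker : Nat.card ψ.ker ≤ p ^ (n + 1) := by
    have h1 : Nat.card ψ.ker * Nat.card ψ.range = p ^ (2 * (n + 1)) := by
      rw [← AddSubgroup.index_ker, AddSubgroup.card_mul_index, hcardT]
    obtain ⟨t, ht⟩ := hdvd
    have ht0 : t ≠ 0 := by
      rintro rfl
      rw [mul_zero] at ht
      rw [ht, mul_zero] at h1
      exact absurd h1.symm (pow_ne_zero _ hp.ne_zero)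
    have h2 : Nat.card ψ.ker * t = p ^ (n + 1) := by
      have h3 : p ^ (n + 1) * (Nat.card ψ.ker * t) = p ^ (n + 1) * p ^ (n + 1) := by
        rw [← pow_add, show n + 1 + (n + 1) = 2 * (n + 1) by ring, ← h1, ht]; ring
      exact Nat.eq_of_mul_eq_mul_left (pow_pos hp.pos _) h3
    calc Nat.card ψ.ker ≤ Nat.card ψ.ker * t := Nat.le_mul_of_pos_right _ (Nat.pos_of_ne_zero ht0)
      _ = p ^ (n + 1) := h2
  have hcard_zmul : Nat.card (AddSubgroup.zmultiples Pt) = p ^ (n + 1) := by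
    rw [Nat.card_zmultiples, hPtord]
  have hkerEq : AddSubgroup.zmultiples Pt = ψ.ker :=
    AddSubgroup.eq_of_le_of_card_ge hle (by rw [hcard_zmul]; exact hcard_ker)
  -- `σ R - R` is annihilated by `P`
  set Rt : geomTorsion E (m : ℤ) := ⟨R, hR⟩ with hRtdef
  have hσPt : σ • Pt = Pt := Subtype.ext (by
    rw [Literature.NumberTheory.EllipticCurves.AddSubgroup.torsionBy.coe_smul]; exact hσP)
  have h1 : e Pt (σ • Rt) = e Pt Rt := by
    conv_lhs => rw [← hσPt]
    rw [← hgal, hσμ (n + 1) _ (hpow Pt Rt)]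
  have h2 : e Pt (σ • Rt - Rt) = 1 := by
    have h := haddr Pt (σ • Rt - Rt) Rt
    rw [sub_add_cancel, h1] at h
    exact ((mul_eq_right₀ (hne Pt Rt)).mp h.symm)
  have hmem : σ • Rt - Rt ∈ AddSubgroup.zmultiples Pt := by
    rw [hkerEq]; exact (hker _).mpr h2
  obtain ⟨j, hj⟩ := AddSubgroup.mem_zmultiples_iff.mp hmem
  refine AddSubgroup.mem_zmultiples_iff.mpr ⟨j, ?_⟩
  have h := congrArg (fun x : geomTorsion E (m : ℤ) ↦ (x : geomPoints E)) hj
  rw [AddSubgroupClass.coe_zsmul, AddSubgroupClass.coe_sub,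
    Literature.NumberTheory.EllipticCurves.AddSubgroup.torsionBy.coe_smul] at h
  exact h
end Summit.BirchSwinnertonDyer.BirchSwinnertonDyer.Theorems.TowerTorsionFiniteOrdinary

end
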